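import Mathlib
import Summits.RiemannHypothesis.RiemannHypothesis.Theorems.SoloInformedGroundStateLimit
import Literature.Analysis.Complex.Hurwitz
import Literature.NumberTheory.LFunctions.RiemannXiProofs
import Literature.NumberTheory.LFunctions.WeilGroundState
import HarnessLib

/-!
# ROUTE R-K «COUNT-AND-THIN»: with the (A)-inputs, SC-3 ALONE gives a zero-free COLLAR `|Re s − 1/2| < δ`

Handoff track (ROUTE 1′), prove-1 gen13; companion of `HandoffCountThin*.lean` (idea-3 gen22 ROUTE
R-K) and of Solo's `SoloInformedGroundStateLimit` (the Hurwitz assembly on the full strip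
`|Im z| < 1/2`). Built imports only.

Solo's `riemannHypothesis_of_tendstoLocallyUniformlyOn` runs Hurwitz on the two open half-strips
`0 < ±Im z < 1/2`; the same argument on the THIN half-strips `0 < ±Im z < δ` gives, from convergence
on the thin strip only:

* `im_eq_zero_of_realZero_of_thinStrip` — `F_n → Ξ` locally uniformly on `{|Im z| < δ}`, `F_n`
  holomorphic there eventually and, frequently, without non-real zeros there ⟹ `Ξ` has no zero with
  `0 < |Im z| < δ`;
* `re_eq_half_of_realZero_of_thinStrip` — in `ζ`-language: every zero `ρ` of `ζ` in the critical
  strip with `|Re ρ − 1/2| < δ` has `Re ρ = 1/2` — a zero-free COLLAR of width `δ` around the critical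
  line, at ALL heights;
* `tendstoLocallyUniformlyOn_thinStrip_of_rect` — idea-3's uniform convergence on the rectangles
  `[-T, T] × [-δ, δ]` for every `T` gives locally uniform convergence on the open thin strip;
* `collar_of_weilGroundStates` — for Weil ground states: the Connes–van Suijlekom fact + (M1)
  eventually + SC-3 on the thin strip of width `δ` ⟹ the collar of width `δ` (Solo's theorem is
  `δ = 1/2`).

READING for the (B)-pair: given the (A)-inputs, THIN(δ) already clears the collar; the count law
SC-2 is then needed only against zeros at distance `≥ δ` from the line. A pure implication; nothing
here is, or suggests, a proof of RH (THIN is Connes's open (M2) near the axis).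
-/

set_option linter.dupNamespace false  -- the mandated namespace repeats `RiemannHypothesis`

noncomputable section

open Filter Set Topology Metric Complex
open Literature.NumberTheory.LFunctions

namespace Summit.RiemannHypothesis.RiemannHypothesis.Theorems

namespace CountThin

/-- The horizontal strip `a < Im z < b` is the preimage of `(a, b)` under `Im`. -/
theorem setOf_im_mem_Ioo_eq (a b : ℝ) : {z : ℂ | a < z.im ∧ z.im < b} = Complex.imLm ⁻¹' Ioo a b := by
  ext z; simp [Complex.imLm_coe]

/-- Horizontal strips are open. -/
theorem isOpen_setOf_im_mem_Ioo (a b : ℝ) : IsOpen {z : ℂ | a < z.im ∧ z.im < b} := by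
  rw [setOf_im_mem_Ioo_eq]
  exact isOpen_Ioo.preimage Complex.continuous_im

/-- Horizontal strips are preconnected (convex). -/
theorem isPreconnected_setOf_im_mem_Ioo (a b : ℝ) : IsPreconnected {z : ℂ | a < z.im ∧ z.im < b} := by
  rw [setOf_im_mem_Ioo_eq]
  exact ((convex_Ioo a b).linear_preimage Complex.imLm).isPreconnected

/-- **Hurwitz on the thin strip.** `F_n → Ξ` locally uniformly on `{|Im z| < δ}` along a non-trivial
filter, `F_n` holomorphic there eventually, and frequently every zero of `F_n` in the thin strip is
real. Then every zero of `Ξ` with `|Im z| < δ` is real. (Hurwitz's theorem on each thin half-strip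
`0 < ±Im z < δ`, which contains no real point; `Ξ ≢ 0`.) -/
theorem im_eq_zero_of_realZero_of_thinStrip {ι : Type*} {l : Filter ι} [l.NeBot]
    (F : ι → ℂ → ℂ) {δ : ℝ} (hF : ∀ᶠ n in l, DifferentiableOn ℂ (F n) {z : ℂ | |z.im| < δ})
    (hreal : ∃ᶠ n in l, ∀ z : ℂ, |z.im| < δ → F n z = 0 → z.im = 0)
    (hlim : TendstoLocallyUniformlyOn F riemannXiUpper l {z : ℂ | |z.im| < δ}) :
    ∀ z : ℂ, riemannXiUpper z = 0 → |z.im| < δ → z.im = 0 := by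
  intro z hz hzδ
  by_contra him
  rcases lt_or_gt_of_ne him with hneg | hpos
  · -- lower thin half-strip
    set U : Set ℂ := {w : ℂ | -δ < w.im ∧ w.im < 0} with hU
    have hUs : U ⊆ {w : ℂ | |w.im| < δ} := fun w hw => abs_lt.mpr ⟨hw.1, by linarith [hw.2, hzδ, abs_nonneg z.im]⟩
    have hzU : z ∈ U := ⟨by linarith [(abs_lt.mp hzδ).1], hneg⟩
    have h0 : ∃ᶠ n in l, ∀ w ∈ U, F n w ≠ 0 := by
      refine hreal.mono fun n hn w hw hw0 => ?_
      have := hn w (hUs hw) hw0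
      exact (lt_irrefl (0 : ℝ)) (this ▸ hw.2)
    rcases Complex.hurwitz_eqOn_zero_or_forall_ne_zero (isOpen_setOf_im_mem_Ioo _ _)
        (isPreconnected_setOf_im_mem_Ioo _ _) (hF.mono fun n hn => hn.mono hUs) (hlim.mono hUs) h0
      with h | h
    · exact not_eqOn_zero_riemannXiUpper (isOpen_setOf_im_mem_Ioo _ _) hzU h
    · exact h z hzU hz
  · -- upper thin half-strip
    set U : Set ℂ := {w : ℂ | 0 < w.im ∧ w.im < δ} with hU
    have hUs : U ⊆ {w : ℂ | |w.im| < δ} := fun w hw => abs_lt.mpr ⟨by linarith [hw.1, hzδ, abs_nonneg z.im], hw.2⟩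
    have hzU : z ∈ U := ⟨hpos, (abs_lt.mp hzδ).2⟩
    have h0 : ∃ᶠ n in l, ∀ w ∈ U, F n w ≠ 0 := by
      refine hreal.mono fun n hn w hw hw0 => ?_
      have := hn w (hUs hw) hw0
      exact (lt_irrefl (0 : ℝ)) (this ▸ hw.1)
    rcases Complex.hurwitz_eqOn_zero_or_forall_ne_zero (isOpen_setOf_im_mem_Ioo _ _)
        (isPreconnected_setOf_im_mem_Ioo _ _) (hF.mono fun n hn => hn.mono hUs) (hlim.mono hUs) h0
      with h | h
    · exact not_eqOn_zero_riemannXiUpper (isOpen_setOf_im_mem_Ioo _ _) hzU h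
    · exact h z hzU hz

/-- **The collar, in `ζ`-language.** Under the hypotheses of `im_eq_zero_of_realZero_of_thinStrip`:
every zero `ρ` of `ζ` in the critical strip with `|Re ρ − 1/2| < δ` lies on the critical line. -/
theorem re_eq_half_of_realZero_of_thinStrip {ι : Type*} {l : Filter ι} [l.NeBot]
    (F : ι → ℂ → ℂ) {δ : ℝ} (hF : ∀ᶠ n in l, DifferentiableOn ℂ (F n) {z : ℂ | |z.im| < δ})
    (hreal : ∃ᶠ n in l, ∀ z : ℂ, |z.im| < δ → F n z = 0 → z.im = 0)
    (hlim : TendstoLocallyUniformlyOn F riemannXiUpper l {z : ℂ | |z.im| < δ}) :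
    ∀ ρ : ℂ, riemannZeta ρ = 0 → 0 < ρ.re → ρ.re < 1 → |ρ.re - 1 / 2| < δ → ρ.re = 1 / 2 := by
  have key := im_eq_zero_of_realZero_of_thinStrip F hF hreal hlim
  intro ρ hζ h0 h1 hρ
  set z : ℂ := -I * (ρ - 1 / 2) with hz
  have hρz : (1 / 2 : ℂ) + I * z = ρ := by
    have : I * I = -1 := Complex.I_mul_I
    simp only [z]; linear_combination (-(ρ - 1 / 2)) * this
  have hΞ : riemannXiUpper z = 0 := by
    rw [riemannXiUpper, hρz]; exact (riemannXi_eq_zero_iff_holds ρ).mpr ⟨hζ, h0, h1⟩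
  have hzim : z.im = 1 / 2 - ρ.re := by simp [z]
  have h := key z hΞ (by rw [hzim, abs_sub_comm]; simpa using hρ)
  rw [hzim] at h
  linarith

/-- **From idea-3's rectangles to the open thin strip.** Uniform convergence on `[-T, T] × [-δ, δ]`
for every `T > 0` gives locally uniform convergence on the open strip `|Im z| < δ`. -/
theorem tendstoLocallyUniformlyOn_thinStrip_of_rect {ι : Type*} {l : Filter ι} {Φ : ι → ℂ → ℂ}
    {g : ℂ → ℂ} {δ : ℝ}
    (h : ∀ T : ℝ, 0 < T → TendstoUniformlyOn Φ g l (Icc (-T) T ×ℂ Icc (-δ) δ)) :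
    TendstoLocallyUniformlyOn Φ g l {z : ℂ | |z.im| < δ} := by
  -- the thin strip is open (the tree's `Literature.NumberTheory.Automorphic.isOpen_setOf_abs_im_lt`,
  -- not imported here to keep the import closure small)
  have hopen : IsOpen {z : ℂ | |z.im| < δ} :=
    isOpen_lt (continuous_abs.comp Complex.continuous_im) continuous_const
  rw [tendstoLocallyUniformlyOn_iff_forall_isCompact hopen]
  intro K hKs hK
  obtain ⟨C, hC⟩ := isBounded_iff_forall_norm_le.mp hK.isBounded
  refine (h (max C 1) (lt_max_of_lt_right one_pos)).mono fun z hz => ?_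
  have hre : |z.re| ≤ max C 1 := ((abs_re_le_norm z).trans (hC z hz)).trans (le_max_left _ _)
  have him : |z.im| < δ := hKs hz
  exact mem_reProdIm.mpr ⟨⟨(abs_le.mp hre).1, (abs_le.mp hre).2⟩, (abs_lt.mp him).1.le, (abs_lt.mp him).2.le⟩

/-- **Ground states: the (A)-inputs and SC-3 on a thin strip give the collar.** Assume the named fact
`Connes2026_weilGroundState_zeros_re_eq_half` (Connes–van Suijlekom). Let `u_n` be ground states on
windows `[-a_n, a_n]` along a non-trivial filter, (M1) eventually, `c_n ≠ 0` eventually, and let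
`z ↦ c_n û_n(1/2 + iz)` converge to `Ξ` locally uniformly on the thin strip `|Im z| < δ`. Then every
zero of `ζ` in the critical strip with `|Re ρ − 1/2| < δ` lies on the critical line. (Solo's
`riemannHypothesis_of_weilGroundStates` is the case `δ = 1/2`.) -/
theorem collar_of_weilGroundStates (hfact : Connes2026_weilGroundState_zeros_re_eq_half)
    {ι : Type*} {l : Filter ι} [l.NeBot] (a : ι → ℝ) (u : ι → ℝ → ℂ) (c : ι → ℂ)
    (hM1 : ∀ᶠ n in l, WeilWindowSimpleEven (a n)) (hu : ∀ᶠ n in l, IsWeilGroundState (a n) (u n))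
    (hc : ∀ᶠ n in l, c n ≠ 0) {δ : ℝ}
    (hthin : TendstoLocallyUniformlyOn (fun n z => c n * weilMellin (u n) (1 / 2 + I * z))
      riemannXiUpper l {z : ℂ | |z.im| < δ}) :
    ∀ ρ : ℂ, riemannZeta ρ = 0 → 0 < ρ.re → ρ.re < 1 → |ρ.re - 1 / 2| < δ → ρ.re = 1 / 2 := by
  refine re_eq_half_of_realZero_of_thinStrip _ ?_ ?_ hthin
  · filter_upwards [hu] with n hn
    exact ((differentiable_const _).mul (hn.differentiable_weilMellin.comp
      ((differentiable_const _).add ((differentiable_const _).mul differentiable_id)))).differentiableOn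
  · refine (hM1.and (hu.and hc)).frequently.mono ?_
    rintro n ⟨h1, h2, h3⟩ z _ hz
    rcases mul_eq_zero.1 hz with h | h
    · exact absurd h h3
    · exact Connes2026_weilGroundState_zeros_re_eq_half.im_eq_zero_of_fourier_eq_zero hfact h1 h2 h

/-- **The same from idea-3's thin rectangles** `[-T, T] × [-δ, δ]`, all `T > 0`. -/
theorem collar_of_weilGroundStates_rect (hfact : Connes2026_weilGroundState_zeros_re_eq_half)
    {ι : Type*} {l : Filter ι} [l.NeBot] (a : ι → ℝ) (u : ι → ℝ → ℂ) (c : ι → ℂ)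
    (hM1 : ∀ᶠ n in l, WeilWindowSimpleEven (a n)) (hu : ∀ᶠ n in l, IsWeilGroundState (a n) (u n))
    (hc : ∀ᶠ n in l, c n ≠ 0) {δ : ℝ}
    (hthin : ∀ T : ℝ, 0 < T → TendstoUniformlyOn (fun n z => c n * weilMellin (u n) (1 / 2 + I * z))
      riemannXiUpper l (Icc (-T) T ×ℂ Icc (-δ) δ)) :
    ∀ ρ : ℂ, riemannZeta ρ = 0 → 0 < ρ.re → ρ.re < 1 → |ρ.re - 1 / 2| < δ → ρ.re = 1 / 2 :=
  collar_of_weilGroundStates hfact a u c hM1 hu hc (tendstoLocallyUniformlyOn_thinStrip_of_rect hthin)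

/-! Axiom census (expected `propext`, `Classical.choice`, `Quot.sound`). -/
#print axioms collar_of_weilGroundStates_rect

end CountThin

end Summit.RiemannHypothesis.RiemannHypothesis.Theorems

end
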